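import Summits.NavierStokesRegularity.FunctionalMining.TopEigStrainMixDeriv
import Summits.NavierStokesRegularity.FunctionalMining.TopEigStrainMixRateBound
import HarnessLib

/-!
# FunctionalMining/NoGo — D-K6 (a): the rate exponent of the mixtures `F_ε = Φ_q + ε Z_q` is at most
# `γ = (3q−3)/(2q−3)` itself (real `q > 2`), and every power-law heat-price family has exponent `s ≤ 1`

Search for candidate a priori estimates; no regularity claim. Cell `pub-nsfunc`, no-go seat (gen 34),
STAGED for the prove seat (the planner seat cannot file under `FunctionalMining/`; see
`pub-nsfunc-nogo/NoGo/STAGING.md`). Imports the prove seat's derivative step `TopEigStrainMixDeriv`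
(fence tools `hasDerivWithinAt_le_of_fence`, `sub_le_mul_of_deriv_right_le`, continuity
`continuousWithinAt_topEigStrainMix` — used BY NAME) and the tree file `TopEigStrainMixRateBound`
(`TopEigStrainMixRate.gamma_mul_le`, L8b).

MECHANISM. The prove seat's `TopEig.exists_topEigStrainMix_rightDeriv_le` bounds the right derivative of
`F_ε(u(s))` by `q ((1+ε)(C_N+C_Q))^{1/(1−e)} (εν)^{−γ} M`, `M = ℰ' · Z_q^{1+1/σ}` (`ℰ' = ∫|S|²`,
`Z_q = ∫|S|^q`, `σ = 2q−3`, `e = (3q−3)/(5q−6)`, `γ = e/(1−e)`), and then spends `ε^{−(1+1/σ)}` on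
`Z_q ≤ ε⁻¹ F_ε`, whence its rate exponent `γ + 1 + 1/σ`. That last step is free of charge: by the
COERCIVITY of the top eigenvalue on trace-free symmetric tensors (`|S| ≤ 6 λ₁`, tree
`TopEig.norm_strainFlat_le`) `Z_q ≤ 6^q Φ_q ≤ 6^q F_ε` for EVERY `ε ≥ 0`, so
`M ≤ 6^{q(1+1/σ)} ℰ' F_ε^{1+1/σ}` uniformly in `ε` and the only `ε`-price left is the Young weight
`(εν)^{−γ}`: `κ(ε) = (q/2) C₀ (1+ε)^{1/(1−e)} ε^{−γ}`, `C₀ = (C_N+C_Q)^{1/(1−e)} 6^{q(1+1/σ)}`. The same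
observation was made independently, in prose, by the dict seat (RATE NOTE D-R3, INBOX l.4395) and is the
admissible density `|S|/6 ≤ g̃` of census-2's C2-LKB-6; this file is its kernel-checked form.

CONTENT (`T³ = UnitAddTorus (Fin 3)`, real `q > 2` unless stated):
* `TopEig.torusStrainMoment_le_topEigMoment` — `Z_q ≤ 6^q Φ_q` for smooth divergence-free fields
  (`q ≥ 0`), and `TopEig.torusStrainMoment_le_topEigStrainMix` — `Z_q ≤ 6^q F_ε` (`ε ≥ 0`);
* **`TopEig.exists_topEigStrainMix_rightDeriv_le_gamma`** — the right derivative of `F_ε(u(s))` at every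
  `t ∈ [a, b)` is `≤ (q/2) C₀ (1+ε)^{1/(1−e)} ε^{−γ} ν^{−γ} (2ℰ) F_ε^{1+1/σ}`, ONE `C₀ = C₀(q) ≥ 0` for all
  `ε > 0`, `ν > 0` and all unforced classical solutions (the prove seat's proof with the one step changed);
* `TopEig.exists_topEigStrainMix_rate_le_gamma` — the same bound for every one-sided derivative value
  within the window (Dini fencing, exactly as in the prove seat's part 2);
* **`TopEig.topEigStrainMixRate_gamma_of_two_lt`** — `2 < q → TopEigStrainMixRate q ((3q−3)/(2q−3))`:
  the dictionary number of escape (a) satisfies `a* ≤ γ` (the dict seat's node `TopEigStrainMixRateGamma q`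
  of its staged `TopEigStrainMixRateOne`, a one-party pen claim there, PROVED for real `q > 2`);
* **`TopEig.mixHeat_exponent_le_one`** — UNCONDITIONAL consequence via (L8b): any family of smooth
  divergence-free zero-mean data with a heat-maximal selection, production floor `c > 0`, budget `≤ B`
  and mixture heat price `0 < H_ε ≤ D ε^s` on `(0, ε₁]` has `s ≤ 1` (the second hand of the dict seat's
  D-R2 'MIXRATE-S-CHECK', kernel-side: no power-law floor design can beat `ε^1`).

NOT claimed: the law at `ε = 0` (refuted: `NoGo/TopEigSaturatingKill`), any statement for `q = 2` or
`3/2 < q < 2`, any lower bound on the exponent (the floor of record is logarithmic,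
`NoGo/TopEigStrainMixLogRate` staged), and nothing about Navier–Stokes regularity. The node
`TopEigStrainMixLaw q ε` itself is the prove seat's (`TopEigStrainMixLawHolds`) and is not restated here.
[ours]
FILING (prove seat g25, REQUEST #16): declarations byte-identical to the no-go seat's staged `TopEigStrainMixRateGamma.STAGING.lean` 50ddf585a50c2620; this line is the only addition.
-/

noncomputable section

open MeasureTheory Set Filter Topology Finset

namespace Summit.NavierStokesRegularity.FunctionalMining

open Literature.Analysis.FunctionSpaces Literature.Analysis.FluidPDE

namespace TopEig

open StrainL4 StrainMoment VorticityL4 StrainTensor Torus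

variable {q : ℝ}

/-! ## 1. Coercivity: `Z_q ≤ 6^q Φ_q ≤ 6^q F_ε` -/

/-- **`Z_q ≤ 6^q Φ_q` on `T³`:** `∫|S|^q ≤ 6^q ∫(λ₁⁺)^q` for smooth divergence-free `v` and `q ≥ 0`
(pointwise `|S| ≤ 6 λ₁`, `TopEig.norm_strainFlat_le`). [ours, bookkeeping] -/
theorem torusStrainMoment_le_topEigMoment (hq : 0 ≤ q) {v : UnitAddTorus (Fin 3) → EuclideanSpace ℝ (Fin 3)}
    (hv : Torus.IsSmooth v) (hdiv : Torus.IsDivFree v) :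
    torusStrainMoment q v ≤ (6 : ℝ) ^ q * torusTopEigMoment q v := by
  rw [torusStrainMoment_eq_integral_norm, torusTopEigMoment_eq hv hdiv q, ← integral_const_mul]
  have hρc : Continuous fun x => lam (strainFlat v x) := continuous_lam.comp (continuous_strainFlat hv)
  refine integral_mono_of_nonneg (ae_of_all _ fun x => Real.rpow_nonneg (norm_nonneg _) _)
    (((hρc.rpow_const fun x => Or.inr hq).const_mul _).integrable_unitAddTorus)
    (ae_of_all _ fun x => ?_)
  show ‖strainFlat v x‖ ^ q ≤ (6 : ℝ) ^ q * lam (strainFlat v x) ^ q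
  rw [← Real.mul_rpow (by norm_num) (lam_strainFlat_nonneg hv hdiv x)]
  exact Real.rpow_le_rpow (norm_nonneg _) (norm_strainFlat_le hv hdiv x) hq

/-- **`Z_q ≤ 6^q F_ε` on `T³`** for every `ε ≥ 0` (`Φ_q ≤ F_ε`). [ours, bookkeeping] -/
theorem torusStrainMoment_le_topEigStrainMix (hq : 0 ≤ q) {ε : ℝ} (hε : 0 ≤ ε)
    {v : UnitAddTorus (Fin 3) → EuclideanSpace ℝ (Fin 3)} (hv : Torus.IsSmooth v) (hdiv : Torus.IsDivFree v) :
    torusStrainMoment q v ≤ (6 : ℝ) ^ q * topEigStrainMix q ε v := by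
  have h1 := torusStrainMoment_le_topEigMoment hq hv hdiv
  have h2 : torusTopEigMoment q v ≤ topEigStrainMix q ε v := by
    have := mul_nonneg hε (torusStrainMoment_nonneg q v)
    unfold topEigStrainMix; linarith
  exact h1.trans (mul_le_mul_of_nonneg_left h2 (Real.rpow_nonneg (by norm_num) _))

/-! ## 2. The right derivative of `F_ε(u(s))` with the `ε^{−γ}` budget -/

/-- **The right derivative of `F_ε = Φ_q + ε Z_q` along Navier–Stokes, `ε^{−γ}` budget.** For real
`q > 2` there is `C₀ ≥ 0` (depending on `q` only) such that for every `ε > 0`, every `ν > 0` and every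
classical solution of unforced Navier–Stokes on `T³ × [a, b]`, at every `t ∈ [a, b)`: `s ↦ F_ε(u(s))` has a
right derivative `R` within `[t, ∞)` with
`R ≤ (q/2) C₀ (1+ε)^{1/(1−e)} ε^{−γ} ν^{−γ} (2ℰ(u t)) F_ε(u t)^{1+1/σ}`
(`e = (3q−3)/(5q−6)`, `σ = 2q−3`, `γ = (3q−3)/(2q−3)`). The prove seat's
`exists_topEigStrainMix_rightDeriv_le` with its step `Z_q ≤ ε⁻¹ F_ε` replaced by `Z_q ≤ 6^q F_ε`. [ours] -/
theorem exists_topEigStrainMix_rightDeriv_le_gamma (hq : 2 < q) :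
    ∃ C₀ : ℝ, 0 ≤ C₀ ∧ ∀ {ε : ℝ}, 0 < ε → ∀ {ν a b : ℝ}, 0 < ν → a < b →
      ∀ {u : ℝ → UnitAddTorus (Fin 3) → EuclideanSpace ℝ (Fin 3)} {p : ℝ → UnitAddTorus (Fin 3) → ℝ},
      Torus.IsClassicalNSSolutionOn (Icc a b) ν 0 u p → ∀ {t : ℝ}, t ∈ Ico a b →
      ∃ R : ℝ, HasDerivWithinAt (fun s => topEigStrainMix q ε (u s)) R (Ici t) t ∧
        R ≤ q / 2 * C₀ * (1 + ε) ^ (1 / (1 - (3 * q - 3) / (5 * q - 6))) *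
          ε ^ (-((3 * q - 3) / (2 * q - 3))) * ν ^ (-((3 * q - 3) / (2 * q - 3))) *
          ((2 * torusEnstrophy (u t)) * topEigStrainMix q ε (u t) ^ (1 + (2 * q - 3)⁻¹)) := by
  -- the static constants of the strain-moment chain
  obtain ⟨CT, hCT0, hCT⟩ := exists_top_rpow hq
  obtain ⟨K, hK0, hK⟩ := exists_cz_rpow (q := q) (by linarith)
  obtain ⟨CP, hCP0, hCP⟩ := exists_hess_rpow (d := Fin 3) (q := q) (by linarith)
  obtain ⟨e, he⟩ : ∃ e : ℝ, e = (3 * q - 3) / (5 * q - 6) := ⟨_, rfl⟩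
  obtain ⟨CN, hCN⟩ : ∃ C : ℝ, C = Real.sqrt 2 * K ^ (1 / q) * CT ^ (e / 3) := ⟨_, rfl⟩
  obtain ⟨CQ, hCQ⟩ : ∃ C : ℝ,
      C = Real.sqrt 2 * ((9 : ℝ) ^ q * CP * K) ^ (1 / q) * CT ^ (e / 3) := ⟨_, rfl⟩
  have h56 : 0 < 5 * q - 6 := by linarith
  have h23 : 0 < 2 * q - 3 := by linarith
  have he0 : 0 < e := by rw [he]; exact div_pos (by linarith) h56
  have he1 : e < 1 := by rw [he, div_lt_one h56]; linarith
  have h1e : 1 - e = (2 * q - 3) / (5 * q - 6) := by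
    rw [he, one_sub_div h56.ne']; congr 1; ring
  have hγ : e / (1 - e) = (3 * q - 3) / (2 * q - 3) := by
    rw [h1e, he, div_div_div_cancel_right₀ h56.ne']
  have h9 : 0 ≤ (9 : ℝ) ^ q * CP * K := by positivity
  have hCN0 : 0 ≤ CN := by rw [hCN]; positivity
  have hCQ0 : 0 ≤ CQ := by rw [hCQ]; positivity
  have hC0 : 0 ≤ CN + CQ := add_nonneg hCN0 hCQ0
  have h6 : 0 ≤ (6 : ℝ) ^ q := Real.rpow_nonneg (by norm_num) _
  refine ⟨(CN + CQ) ^ (1 / (1 - e)) * ((6 : ℝ) ^ q) ^ (1 + (2 * q - 3)⁻¹),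
    mul_nonneg (Real.rpow_nonneg hC0 _) (Real.rpow_nonneg h6 _), ?_⟩
  intro ε hε ν a b hν hab u p hsol t ht
  have ht' : t ∈ Icc a b := ⟨ht.1, ht.2.le⟩
  have hq1 : (1 : ℝ) ≤ q := by linarith
  have hq0 : (0 : ℝ) ≤ q := by linarith
  have hut : IsSmooth (u t) := hsol.smooth_velocity.isSmooth_slice ht'
  have hdiv : IsDivFree (u t) := hsol.divFree t ht'
  -- opaque names for the slice quantities
  obtain ⟨XN, hXN⟩ : ∃ X : ℝ, X = ∫ x, torusStrainSqAt (u t) x ^ (q / 2 - 1) * ∑ i, ∑ j,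
      (partialDeriv j (u t) x i + partialDeriv i (u t) x j) / 2 *
        ∑ k, partialDeriv i (u t) x k * partialDeriv k (u t) x j := ⟨_, rfl⟩
  obtain ⟨XP, hXP⟩ : ∃ X : ℝ, X = ∫ x, torusStrainSqAt (u t) x ^ (q / 2 - 1) * ∑ i, ∑ j,
      (partialDeriv j (u t) x i + partialDeriv i (u t) x j) / 2 *
        partialDeriv i (partialDeriv j (p t)) x := ⟨_, rfl⟩
  obtain ⟨I', hI'⟩ : ∃ I : ℝ, I = ∫ x, torusStrainSqAt (u t) x ^ (q / 2 - 1) * ∑ k, ∑ i, ∑ j,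
      ((partialDeriv k (partialDeriv j (u t)) x i +
        partialDeriv k (partialDeriv i (u t)) x j) / 2) ^ 2 := ⟨_, rfl⟩
  obtain ⟨I, hI⟩ : ∃ I : ℝ, I = ∫ x, ‖strainFlat (u t) x‖ ^ (q - 2) * ∑ k, ∑ i, ∑ j,
      ((partialDeriv k (partialDeriv j (u t)) x i +
        partialDeriv k (partialDeriv i (u t)) x j) / 2) ^ 2 := ⟨_, rfl⟩
  obtain ⟨Z, hZ⟩ : ∃ Z : ℝ, Z = ∫ x, ‖strainFlat (u t) x‖ ^ (2 : ℝ) := ⟨_, rfl⟩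
  obtain ⟨F, hFq⟩ : ∃ F : ℝ, F = ∫ x, ‖strainFlat (u t) x‖ ^ q := ⟨_, rfl⟩
  obtain ⟨M, hM⟩ : ∃ M : ℝ, M = Z * F ^ (1 + (2 * q - 3)⁻¹) := ⟨_, rfl⟩
  obtain ⟨NP, hNP⟩ : ∃ N : ℝ, N = ∫ x, q * torusStrainTopEig (u t) x ^ (q - 1) *
      dirTopEig (strainFlat (u t) x) (-pressVec (p t) x - nonlinVec (u t) x) := ⟨_, rfl⟩
  have hII : I' = I := by
    rw [hI', hI]
    exact integral_congr_ae (ae_of_all _ fun x => by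
      show torusStrainSqAt (u t) x ^ (q / 2 - 1) * _ = ‖strainFlat (u t) x‖ ^ (q - 2) * _
      rw [strainSqAt_rpow_half_sub_one])
  have hI0 : 0 ≤ I := by
    rw [hI]; exact integral_nonneg fun x => mul_nonneg (Real.rpow_nonneg (norm_nonneg _) _)
      (Finset.sum_nonneg fun k _ => Finset.sum_nonneg fun i _ =>
        Finset.sum_nonneg fun j _ => sq_nonneg _)
  have hZ0 : 0 ≤ Z := by rw [hZ]; exact integral_nonneg fun x => Real.rpow_nonneg (norm_nonneg _) _
  have hF0 : 0 ≤ F := by rw [hFq]; exact integral_nonneg fun x => Real.rpow_nonneg (norm_nonneg _) _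
  have hpw : 0 ≤ 1 + (2 * q - 3)⁻¹ := by have := inv_pos.2 h23; linarith
  have hM0 : 0 ≤ M := by rw [hM]; exact mul_nonneg hZ0 (Real.rpow_nonneg hF0 _)
  have hsplit : (CT * I ^ 3) ^ (e / 3) = CT ^ (e / 3) * I ^ e := by
    rw [Real.mul_rpow hCT0 (pow_nonneg hI0 3), ← Real.rpow_natCast I 3, ← Real.rpow_mul hI0]
    congr 2
    push_cast
    ring
  -- the static bounds of the strain-moment productions and of the Euler production of `Φ_q`
  have hstatN : |XN| ≤ CN * I ^ e * M ^ (1 - e) := by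
    have h := nonlinear_production_rpow_le hK0 hq hCT hK hut hdiv
    rw [← hXN, ← hI, ← hZ, ← hFq, ← he, ← hM, hsplit] at h
    calc |XN| ≤ Real.sqrt 2 * K ^ (1 / q) * (CT ^ (e / 3) * I ^ e) * M ^ (1 - e) := h
      _ = CN * I ^ e * M ^ (1 - e) := by rw [hCN]; ring
  have hstatP : |XP| ≤ CQ * I ^ e * M ^ (1 - e) := by
    have h := pressure_production_rpow_le hK0 hCP0 hq hCT hK hsol
      (fun s hs i j => hCP hab hsol s hs i j) ht'
    rw [← hXP, ← hI, ← hZ, ← hFq, ← he, ← hM, hsplit] at h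
    calc |XP| ≤ Real.sqrt 2 * ((9 : ℝ) ^ q * CP * K) ^ (1 / q) * (CT ^ (e / 3) * I ^ e) *
        M ^ (1 - e) := h
      _ = CQ * I ^ e * M ^ (1 - e) := by rw [hCQ]; ring
  have hstatE : NP ≤ q * ((CN + CQ) * I ^ e * M ^ (1 - e)) := by
    have h := eulerProduction_le_chain hK0 hCP0 hCT0 hq hCT hK hsol
      (fun s hs i j => hCP hab hsol s hs i j) ht'
    rw [← hNP, ← hI, ← hZ, ← hFq, ← he, ← hM] at h
    calc NP ≤ q * ((Real.sqrt 2 * K ^ (1 / q) * CT ^ (e / 3) +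
          Real.sqrt 2 * ((9 : ℝ) ^ q * CP * K) ^ (1 / q) * CT ^ (e / 3)) * I ^ e * M ^ (1 - e)) := h
      _ = q * ((CN + CQ) * I ^ e * M ^ (1 - e)) := by rw [hCN, hCQ]
  -- the right derivative of `Φ_q` (transport-free), with the heat sieve `T_q ≥ 0`
  obtain ⟨RΦ, hRΦ, hRΦle, -⟩ := hasDerivWithinAt_topEigMoment_le_heat_add_production hν.le hsol hab hq1 ht
  have hT0 : 0 ≤ heatDissipation (torusTopEigMoment q) (u t) :=
    heatDissipation_nonneg_of_admissible hq1 convexOn_lam lipschitzWith_lam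
      (fun _ hv hdv x => lam_strainFlat_nonneg hv hdv x)
      (fun _ hv hdv => torusTopEigMoment_eq hv hdv q) hut hdiv
  have hNPeq : ∫ x, q * torusStrainTopEig (u t) x ^ (q - 1) * dirTopEig (strainFlat (u t) x)
      (-pressVec (p t) x + strainFlat ((0 : ℝ → UnitAddTorus (Fin 3) → EuclideanSpace ℝ (Fin 3)) t) x -
        nonlinVec (u t) x) = NP := by
    rw [hNP]
    exact integral_congr_ae (ae_of_all _ fun x => by simp only [Pi.zero_apply, strainFlat_zero, add_zero])
  have hRΦ' : RΦ ≤ q * ((CN + CQ) * I ^ e * M ^ (1 - e)) := by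
    rw [hNPeq] at hRΦle
    have : -(ν * heatDissipation (torusTopEigMoment q) (u t)) ≤ 0 := by
      have := mul_nonneg hν.le hT0; linarith
    linarith
  -- the derivative of `Z_q` within the window, moved to `[t, ∞)`
  obtain ⟨hdiffZ, hleZ⟩ := GradientTensor.derivWithin_Bq_le hab hν.le hsol hq ht'
  rw [← hXN, ← hXP, ← hI', hII] at hleZ
  obtain ⟨DZ, hDZ⟩ : ∃ D : ℝ,
      D = derivWithin (fun s => ∫ x, torusStrainSqAt (u s) x ^ (q / 2)) (Icc a b) t := ⟨_, rfl⟩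
  rw [← hDZ] at hleZ
  have hZder : HasDerivWithinAt (fun s => torusStrainMoment q (u s)) DZ (Ici t) t := by
    have h1 : HasDerivWithinAt (fun s => ∫ x, torusStrainSqAt (u s) x ^ (q / 2)) DZ (Icc a b) t := by
      rw [hDZ]; exact hdiffZ.hasDerivWithinAt
    have hmem : Icc a b ∈ 𝓝[Ici t] t := by
      have h2 : Ici t ∩ Iio b ∈ 𝓝[Ici t] t := inter_mem_nhdsWithin _ (Iio_mem_nhds ht.2)
      exact Filter.mem_of_superset h2 fun y hy => ⟨ht.1.trans hy.1, hy.2.le⟩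
    exact h1.mono_of_mem_nhdsWithin hmem
  have hDZle : DZ ≤ -(q * ν * I) + q * ((CN + CQ) * I ^ e * M ^ (1 - e)) := by
    have hXN' : -XN ≤ |XN| := neg_le_abs XN
    have hXP' : -XP ≤ |XP| := neg_le_abs XP
    have h1 : -XN + -XP ≤ (CN + CQ) * I ^ e * M ^ (1 - e) := by
      have := add_le_add (hXN'.trans hstatN) (hXP'.trans hstatP); linarith
    have h2 := mul_le_mul_of_nonneg_left h1 hq0
    linarith
  -- the right derivative of `F_ε`
  have hΦder : HasDerivWithinAt (fun s => torusTopEigMoment q (u s)) RΦ (Ici t) t :=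
    hasDerivWithinAt_Ioi_iff_Ici.1 hRΦ
  have hFder : HasDerivWithinAt (fun s => topEigStrainMix q ε (u s)) (RΦ + ε * DZ) (Ici t) t :=
    hΦder.add (hZder.const_mul ε)
  refine ⟨RΦ + ε * DZ, hFder, ?_⟩
  -- Young with the weight `εν`
  have hεν : 0 < ε * ν := mul_pos hε hν
  have ha0 : 0 ≤ (1 + ε) * (CN + CQ) := mul_nonneg (by linarith) hC0
  have hY := VorticityMoment.young_rpow he0 he1 ha0 hI0 hM0 hεν
  obtain ⟨P, hP⟩ : ∃ P : ℝ, P = (CN + CQ) * I ^ e * M ^ (1 - e) := ⟨_, rfl⟩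
  rw [← hP] at hRΦ' hDZle
  have hY' : (1 + ε) * P - ε * ν * I ≤
      ((1 + ε) * (CN + CQ)) ^ (1 / (1 - e)) * (ε * ν) ^ (-(e / (1 - e))) * M := by
    have e0 : (1 + ε) * (CN + CQ) * I ^ e * M ^ (1 - e) = (1 + ε) * P := by rw [hP]; ring
    rw [e0] at hY
    linarith
  have hstep1 : RΦ + ε * DZ ≤ q * (((1 + ε) * (CN + CQ)) ^ (1 / (1 - e)) * (ε * ν) ^ (-(e / (1 - e))) * M) := by
    have h2 : ε * DZ ≤ ε * (-(q * ν * I) + q * P) := mul_le_mul_of_nonneg_left hDZle hε.le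
    have h1 : RΦ + ε * DZ ≤ q * ((1 + ε) * P - ε * ν * I) := by
      have h3 := add_le_add hRΦ' h2
      have e0 : q * P + ε * (-(q * ν * I) + q * P) = q * ((1 + ε) * P - ε * ν * I) := by ring
      linarith
    exact h1.trans (mul_le_mul_of_nonneg_left hY' hq0)
  -- THE CHANGED STEP: `M ≤ 6^{q(1+1/σ)} ℰ' F_ε^{1+1/σ}` by coercivity, uniformly in `ε`
  have hZE : Z = torusEnstrophy (u t) := by rw [hZ]; exact (torusEnstrophy_eq_integral_norm_sq hut hdiv).symm
  have hFZ : F = torusStrainMoment q (u t) := by rw [hFq, torusStrainMoment_eq_integral_norm]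
  have hFε0 : 0 ≤ topEigStrainMix q ε (u t) := topEigStrainMix_nonneg hε.le _
  have hFle : F ≤ (6 : ℝ) ^ q * topEigStrainMix q ε (u t) := by
    rw [hFZ]; exact torusStrainMoment_le_topEigStrainMix hq0 hε.le hut hdiv
  have hMle : M ≤ ((6 : ℝ) ^ q) ^ (1 + (2 * q - 3)⁻¹) * (torusEnstrophy (u t) *
      topEigStrainMix q ε (u t) ^ (1 + (2 * q - 3)⁻¹)) := by
    rw [hM, ← hZE]
    have h1 : F ^ (1 + (2 * q - 3)⁻¹) ≤ ((6 : ℝ) ^ q * topEigStrainMix q ε (u t)) ^ (1 + (2 * q - 3)⁻¹) :=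
      Real.rpow_le_rpow hF0 hFle hpw
    rw [Real.mul_rpow h6 hFε0] at h1
    calc Z * F ^ (1 + (2 * q - 3)⁻¹)
        ≤ Z * (((6 : ℝ) ^ q) ^ (1 + (2 * q - 3)⁻¹) * topEigStrainMix q ε (u t) ^ (1 + (2 * q - 3)⁻¹)) :=
          mul_le_mul_of_nonneg_left h1 hZ0
      _ = _ := by ring
  -- assemble
  have hA0 : 0 ≤ q * (((1 + ε) * (CN + CQ)) ^ (1 / (1 - e)) * (ε * ν) ^ (-(e / (1 - e)))) :=
    mul_nonneg hq0 (mul_nonneg (Real.rpow_nonneg ha0 _) (Real.rpow_nonneg hεν.le _))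
  have hstep2 : RΦ + ε * DZ ≤ q * (((1 + ε) * (CN + CQ)) ^ (1 / (1 - e)) * (ε * ν) ^ (-(e / (1 - e)))) *
      (((6 : ℝ) ^ q) ^ (1 + (2 * q - 3)⁻¹) * (torusEnstrophy (u t) *
        topEigStrainMix q ε (u t) ^ (1 + (2 * q - 3)⁻¹))) := by
    calc RΦ + ε * DZ ≤ q * (((1 + ε) * (CN + CQ)) ^ (1 / (1 - e)) * (ε * ν) ^ (-(e / (1 - e))) * M) := hstep1
      _ = q * (((1 + ε) * (CN + CQ)) ^ (1 / (1 - e)) * (ε * ν) ^ (-(e / (1 - e)))) * M := by ring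
      _ ≤ _ := mul_le_mul_of_nonneg_left hMle hA0
  have e1 : ((1 + ε) * (CN + CQ)) ^ (1 / (1 - e)) = (1 + ε) ^ (1 / (1 - e)) * (CN + CQ) ^ (1 / (1 - e)) :=
    Real.mul_rpow (by linarith) hC0
  have e2 : (ε * ν) ^ (-(e / (1 - e))) = ε ^ (-(e / (1 - e))) * ν ^ (-(e / (1 - e))) :=
    Real.mul_rpow hε.le hν.le
  rw [← he, ← hγ]
  calc RΦ + ε * DZ ≤ _ := hstep2
    _ = q / 2 * ((CN + CQ) ^ (1 / (1 - e)) * ((6 : ℝ) ^ q) ^ (1 + (2 * q - 3)⁻¹)) * (1 + ε) ^ (1 / (1 - e)) *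
        ε ^ (-(e / (1 - e))) * ν ^ (-(e / (1 - e))) *
        (2 * torusEnstrophy (u t) * topEigStrainMix q ε (u t) ^ (1 + (2 * q - 3)⁻¹)) := by
      rw [e1, e2]; ring

/-! ## 3. Derivative values within the window, the rate exponent `γ`, and `s ≤ 1` -/

/-- **Every one-sided derivative value of `F_ε(u(s))` within the window obeys the `ε^{−γ}` budget** (real
`q > 2`, one `C₀` for all `ε > 0`): Dini fencing from the right derivatives of §2 and the continuity of
`F_ε(u(s))`, exactly as in the prove seat's `exists_topEigStrainMix_rate_le`. [ours] -/
theorem exists_topEigStrainMix_rate_le_gamma (hq : 2 < q) :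
    ∃ C₀ : ℝ, 0 ≤ C₀ ∧ ∀ {ε : ℝ}, 0 < ε → ∀ {ν a b : ℝ}, 0 < ν → a < b →
      ∀ {u : ℝ → UnitAddTorus (Fin 3) → EuclideanSpace ℝ (Fin 3)} {p : ℝ → UnitAddTorus (Fin 3) → ℝ},
      Torus.IsClassicalNSSolutionOn (Icc a b) ν 0 u p →
      ∀ t ∈ Icc a b, ∀ R : ℝ, HasDerivWithinAt (fun s => topEigStrainMix q ε (u s)) R (Icc a b) t →
        R ≤ q / 2 * C₀ * (1 + ε) ^ (1 / (1 - (3 * q - 3) / (5 * q - 6))) *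
          ε ^ (-((3 * q - 3) / (2 * q - 3))) * ν ^ (-((3 * q - 3) / (2 * q - 3))) *
          ((2 * torusEnstrophy (u t)) * topEigStrainMix q ε (u t) ^ (1 + (2 * q - 3)⁻¹)) := by
  obtain ⟨C₀, hC₀, hder⟩ := exists_topEigStrainMix_rightDeriv_le_gamma hq
  refine ⟨C₀, hC₀, ?_⟩
  intro ε hε ν a b hν hab u p hsol t ht R hR
  have h23 : 0 < 2 * q - 3 := by linarith
  have hpw : 0 ≤ 1 + (2 * q - 3)⁻¹ := by have := inv_pos.2 h23; linarith
  set κ : ℝ := q / 2 * C₀ * (1 + ε) ^ (1 / (1 - (3 * q - 3) / (5 * q - 6))) *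
    ε ^ (-((3 * q - 3) / (2 * q - 3))) * ν ^ (-((3 * q - 3) / (2 * q - 3))) with hκ
  set bud : ℝ → ℝ := fun s => κ * ((2 * torusEnstrophy (u s)) *
    topEigStrainMix q ε (u s) ^ (1 + (2 * q - 3)⁻¹)) with hbud
  show R ≤ bud t
  have hcont : ContinuousWithinAt bud (Icc a b) t := by
    have hE : ContinuousWithinAt (fun s => torusEnstrophy (u s)) (Icc a b) t :=
      (hsol.hasDerivWithinAt_half_gradNormSq hab ht).continuousWithinAt
    have hF := continuousWithinAt_topEigStrainMix hq ε hν.le hab hsol ht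
    exact continuousWithinAt_const.mul ((continuousWithinAt_const.mul hE).mul
      (hF.rpow_const (Or.inr hpw)))
  have hfence : ∀ ⦃t₁ t₂ : ℝ⦄, t₁ ∈ Icc a b → t₂ ∈ Icc a b → t₁ ≤ t₂ → ∀ ⦃K : ℝ⦄,
      (∀ σ ∈ Icc t₁ t₂, bud σ ≤ K) →
      topEigStrainMix q ε (u t₂) - topEigStrainMix q ε (u t₁) ≤ K * (t₂ - t₁) := by
    intro t₁ t₂ ht₁ ht₂ h12 K hK
    have hcontF : ContinuousOn (fun s => topEigStrainMix q ε (u s)) (Icc t₁ t₂) := fun s hs =>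
      (continuousWithinAt_topEigStrainMix hq ε hν.le hab hsol ⟨ht₁.1.trans hs.1, hs.2.trans ht₂.2⟩).mono
        (Icc_subset_Icc ht₁.1 ht₂.2)
    have hD : ∀ x ∈ Ico t₁ t₂, ∃ R' : ℝ,
        HasDerivWithinAt (fun s => topEigStrainMix q ε (u s)) R' (Ici x) x ∧ R' ≤ K := by
      intro x hx
      have hxab : x ∈ Ico a b := ⟨ht₁.1.trans hx.1, lt_of_lt_of_le hx.2 ht₂.2⟩
      obtain ⟨R', hR', hle⟩ := hder hε hν hab hsol hxab
      exact ⟨R', hR', hle.trans (hK x ⟨hx.1, hx.2.le⟩)⟩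
    choose! f' hf' hf'le using hD
    exact sub_le_mul_of_deriv_right_le h12 hcontF (fun x hx => hf' x hx) (fun x hx => hf'le x hx)
  exact hasDerivWithinAt_le_of_fence hab ht hcont hfence hR

/-- **`a* ≤ γ`: the dictionary number of escape (a) is at most `γ = (3q−3)/(2q−3)`** (real `q > 2`):
`TopEigStrainMixRate q ((3q−3)/(2q−3))` on `T³` — for all `ε ∈ (0, 1]` the saturating law for `F_ε` holds
with constant `C ε^{−γ}`, `C = (q/2) C₀ 2^{1/(1−e)}`. This is the dict seat's node
`TopEigStrainMixRateGamma q` (staged `TopEigStrainMixRateOne`), proved. [ours] -/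
theorem topEigStrainMixRate_gamma_of_two_lt (hq : 2 < q) :
    TopEigStrainMixRate (d := Fin 3) q ((3 * q - 3) / (2 * q - 3)) := by
  obtain ⟨C₀, hC₀, h⟩ := exists_topEigStrainMix_rate_le_gamma hq
  have h56 : 0 < 5 * q - 6 := by linarith
  have h1e : 0 < 1 - (3 * q - 3) / (5 * q - 6) := by
    rw [sub_pos, div_lt_one h56]; linarith
  refine ⟨q / 2 * C₀ * (2 : ℝ) ^ (1 / (1 - (3 * q - 3) / (5 * q - 6))), 1, one_pos, ?_⟩
  intro ε hε hε1 _ ν hν a b hab u p hsol _ t ht R hR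
  have h1 := h hε hν hab hsol t ht R hR
  have hq0 : 0 ≤ q / 2 := by linarith
  have hpow : (1 + ε) ^ (1 / (1 - (3 * q - 3) / (5 * q - 6))) ≤
      (2 : ℝ) ^ (1 / (1 - (3 * q - 3) / (5 * q - 6))) :=
    Real.rpow_le_rpow (by linarith) (by linarith) (le_of_lt (div_pos one_pos h1e))
  have hx : 0 ≤ ε ^ (-((3 * q - 3) / (2 * q - 3))) * ν ^ (-((3 * q - 3) / (2 * q - 3))) *
      ((2 * torusEnstrophy (u t)) * topEigStrainMix q ε (u t) ^ (1 + (2 * q - 3)⁻¹)) :=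
    mul_nonneg (mul_nonneg (Real.rpow_nonneg hε.le _) (Real.rpow_nonneg hν.le _))
      (mul_nonneg (mul_nonneg (by norm_num) (torusEnstrophy_nonneg _))
        (Real.rpow_nonneg (topEigStrainMix_nonneg hε.le _) _))
  calc R ≤ q / 2 * C₀ * (1 + ε) ^ (1 / (1 - (3 * q - 3) / (5 * q - 6))) *
        (ε ^ (-((3 * q - 3) / (2 * q - 3))) * ν ^ (-((3 * q - 3) / (2 * q - 3))) *
        ((2 * torusEnstrophy (u t)) * topEigStrainMix q ε (u t) ^ (1 + (2 * q - 3)⁻¹))) := by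
        calc R ≤ _ := h1
          _ = _ := by ring
    _ ≤ q / 2 * C₀ * (2 : ℝ) ^ (1 / (1 - (3 * q - 3) / (5 * q - 6))) *
        (ε ^ (-((3 * q - 3) / (2 * q - 3))) * ν ^ (-((3 * q - 3) / (2 * q - 3))) *
        ((2 * torusEnstrophy (u t)) * topEigStrainMix q ε (u t) ^ (1 + (2 * q - 3)⁻¹))) :=
        mul_le_mul_of_nonneg_right (mul_le_mul_of_nonneg_left hpow (mul_nonneg hq0 hC₀)) hx
    _ = _ := by ring

/-- **`s ≤ 1` for every power-law heat-price family (UNCONDITIONAL, real `q > 2`).** If for all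
`ε ∈ (0, ε₁]` there are smooth divergence-free zero-mean data `w` with a heat-maximal selection `e`
(integrable production density), production `c ≤ P_ε(w; e)` (`c > 0`), budget
`(2ℰ w) F_ε(w)^{1+1/σ} ≤ B` and mixture heat price `0 < H_ε(w) ≤ D ε^s` (`D > 0`), then `s ≤ 1`: by (L8b)
`γ s ≤ a` for every certified rate exponent `a`, and `a = γ` is certified above. No family is exhibited
here (the family of record, W18, has a logarithmic price: `NoGo/TopEigStrainMixLogRate`).
[ours; D-K6 (a): the kernel side of the dict seat's MIXRATE-S-CHECK] -/
theorem mixHeat_exponent_le_one {s c B D ε₁ : ℝ} (hq : 2 < q) (hc : 0 < c) (hD : 0 < D) (hε₁ : 0 < ε₁)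
    (hfam : ∀ ε : ℝ, 0 < ε → ε ≤ ε₁ →
      ∃ w : UnitAddTorus (Fin 3) → EuclideanSpace ℝ (Fin 3),
        Torus.IsSmooth w ∧ Torus.IsDivFree w ∧ Torus.HasZeroMean w ∧
        ∃ e : UnitAddTorus (Fin 3) → Fin 3 → ℝ, IsHeatMaxSelection w e ∧
          Integrable (fun x => q * torusStrainTopEig w x ^ (q - 1) *
            quad (eulerStrainVec w x) (e x)) volume ∧
          c ≤ mixSelProduction q ε w e ∧
          2 * torusEnstrophy w * topEigStrainMix q ε w ^ (1 + (2 * q - 3)⁻¹) ≤ B ∧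
          0 < mixHeat q ε w ∧ mixHeat q ε w ≤ D * ε ^ s) :
    s ≤ 1 := by
  have hγ0 : 0 < (3 * q - 3) / (2 * q - 3) := div_pos (by linarith) (by linarith)
  have h := TopEigStrainMixRate.gamma_mul_le (by linarith : (2 : ℝ) ≤ q)
    (topEigStrainMixRate_gamma_of_two_lt hq) hc hD hε₁ hfam
  refine not_lt.mp fun hs => ?_
  have : (3 * q - 3) / (2 * q - 3) * 1 < (3 * q - 3) / (2 * q - 3) * s := mul_lt_mul_of_pos_left hs hγ0
  linarith

end TopEig

end Summit.NavierStokesRegularity.FunctionalMining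

end
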